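import Literature.NumberTheory.ComplexMultiplication.CMTypeBasic
import Literature.NumberTheory.ComplexMultiplication.InducedCMType
import Mathlib.NumberTheory.NumberField.InfinitePlace.Embeddings
import HarnessLib

/-!
# Balanced families of CM types split into balanced blocks of size ≤ 4 after adjoining complementary pairs
# (the ℤ-lattice mechanism behind Hazama 2003 / Milne 2007 Thm. 8.5 «HC for CM abelian varieties ⇐ HC in codimension 2»)

Family `hodge`, layer `Literature/AlgebraicGeometry/HodgeTheory`. Pure finite combinatorics of CM types (no geometry);
the companion `HodgeTheory/CMProductsHodgeConjectureOfCodimTwo` turns it into algebraicity of Hodge classes.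

## The printed context

J. S. Milne, *The Tate conjecture over finite fields (AIM talk)*, arXiv:0709.3040 [Milne2007TateFiniteFieldsAIM], §8
(held `paper:arxiv-0709.3040`, chunks p0015–p0016), VERBATIM: "**Theorem 8.5.** In order to prove the Hodge conjecture for
CM abelian varieties over `ℂ`, it suffices to prove it in codimension `2`. Proof. If the Hodge conjecture holds in
codimension `2`, then Theorem 8.3 shows that it holds for the varieties `A(G,K,ρ_Φ)ⁿ`, but Proposition 8.4 shows that
every CM abelian `A` is isogenous to a subvariety of `A(G,K,ρ_Φ)ⁿ` for some `K` and `n`." with "**Theorem 8.3.** Let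
`A = A(G,K,ρ)`. For every `n ≥ 0`, the `ℚ`-algebra `𝓑*(Aⁿ)` is generated by the classes of degree `≤ 2`. Proof. See
[hazama2003], 7." — F. Hazama, Publ. RIMS **39** (2003) 625–655 [Hazama2003GHCCM], Thm. 7.14 ("`2`-dominated"), Thm. 8.2,
Thm. 8.3 p. 655; announced Proc. Japan Acad. **78A** (2002) [Hazama2002GHCCM], Thm. 7.6.

In Pohlmann's coordinates (Hazama (4.C)/(4.1) p. 631; the tree's `Pohlmann1968_thm1_cmAlgebra`) the Hodge ring `⊗ ℂ` of a
product of CM abelian varieties of CM types `Θ_x` (`x ∈ J`) of one Galois CM field `L` has the basis `[P]`,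
`P ⊆ J × Hom(L, ℂ)` BALANCED, and for the monomials with one eigenline per factor (to which everything reduces)
balancedness of a sub-family `(Θ_x)_{x ∈ T}` reads: every complex embedding `σ` of `L` lies in exactly half of the
`Θ_x`, `x ∈ T` (`IsBalancedOn`). Milne's literal Thm. 8.3 — every balanced family is a DISJOINT UNION of balanced
sub-families of size `2` or `4` — is false (Hazama's own Remark 7.15 p. 650, the tree's barrier
`Barriers/HodgeConjecture/CMHodgeRingNotGeneratedInCodimensionTwo`); what is true, and what Hazama's `2`-dominatedness
with the transport of [Hazama 2000, Prop. 4.2–4.3] uses, is the ℤ-LINEAR version: the lattice of balanced integral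
vectors is generated by its non-negative vectors of mass `2` and `4`. This file proves that statement in the
multiset form the geometry consumes:

* `IsBalancedOn Θ T` — `∀ σ, #{x ∈ T | σ ∈ Θ_x} = #{x ∈ T | σ ∉ Θ_x}`;
* `IsBlockUnion Θ T` — `T` is a disjoint union of BALANCED BLOCKS of size `2` or `4` (inductive);
* **`exists_isBlockUnion_sum_elim`** — for every balanced family `Θ : J → CMType L` (`J` finite, `L` a number field)
  there are finitely many NEW types `Θ' : Fin k → CMType L` such that (i) `Θ'` alone is a block union (indeed a union of
  complementary pairs) and (ii) the enlarged family `Sum.elim Θ Θ' : J ⊕ Fin k → CMType L` is a block union.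

PROOF (ours; elementary). Fix a balanced PAIRED target `H` on `J` (`H_x = Θ₀` on one half of `J`, `= Θ̄₀` on the
other) and induct on the disorder `Σ_x #(Θ_x ∆ H_x)`. If it is positive, some `σ₀ ∈ Θ_x ∖ H_x`; since `Θ` and `H`
are both balanced at `σ₀` there is `x'` with `σ₀ ∈ H_{x'} ∖ Θ_{x'}`. Replace `Θ_x, Θ_{x'}` by their FLIPS at the place
of `σ₀` (`CMTypeOps.flip`): the family stays balanced, the disorder drops by `4`, and the move is paid for by four new
types `a = flip Θ_x`, `ā`, `b = flip Θ_{x'}`, `b̄` (two complementary pairs) and ONE balanced `4`-block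
`{Θ_x, Θ_{x'}, ā, b̄}` — the multiset identity `[Θ_x] + [Θ_{x'}] + [ā] + [b̄] = ([a]+[ā]) + ([b]+[b̄]) − [a] − [b] + …`
of the lattice statement. At disorder `0`, `Θ = H` is a union of complementary pairs.

No geometry, no named fact, no `sorry`. Two predicates with bodies (`IsBalancedOn`, `IsBlockUnion`) and a handful of
[folklore] finite-set lemmas.

## References

* [Milne2007TateFiniteFieldsAIM] J. S. Milne, arXiv:0709.3040, §8: Thm. 8.3, Prop. 8.4, Thm. 8.5.
* [Hazama2003GHCCM] F. Hazama, Publ. RIMS 39 (2003) 625–655: (4.C)/(4.1) p. 631, (4.3) p. 634, Thm. 7.14, Remark 7.15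
  p. 650, Thm. 8.2 p. 651, Thm. 8.3 p. 655.
* [Hazama2002GHCCM] F. Hazama, Proc. Japan Acad. 78A (2002) 72–75, Thm. 7.6.
* [Pohlmann1968] H. Pohlmann, Ann. of Math. 88 (1968) 161–180, Thm. 1.
-/

noncomputable section

open scoped Classical symmDiff
open NumberField NumberField.ComplexEmbedding

namespace Literature.AlgebraicGeometry.HodgeTheory

namespace CMTypeFamily

open Literature.AlgebraicGeometry.Motives (CMType)
open Literature.NumberTheory.ComplexMultiplication (CMTypeOps.bar CMTypeOps.flip CMTypeOps.placeSet
  CMTypeOps.mem_bar_iff CMTypeOps.mem_flip_iff CMTypeOps.mem_iff_conjugate_notMem CMTypeOps.conjugate_mem_iff_notMem)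
open Literature.NumberTheory.ComplexMultiplication.CMTypeOps (bar flip placeSet)

variable {L : Type*} [Field L]

/-! ### Balanced families -/

/-- **A family of CM types `Θ` is balanced on the finite index set `T`** if every complex embedding `σ` of `L`
belongs to exactly as many `Θ_x` (`x ∈ T`) as it misses — Pohlmann's / Hazama's condition
`#(P ∩ S₁ g) = #P/2` (Hazama (4.1)) for the monomials with one eigenline per factor.
[cite: Hazama2003GHCCM, (4.C)/(4.1) p. 631] [cite: Pohlmann1968, Thm. 1] -/
def IsBalancedOn {J : Type*} (Θ : J → CMType L) (T : Finset J) : Prop :=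
  ∀ σ : L →+* ℂ, (T.filter fun x => σ ∈ (Θ x).1).card = (T.filter fun x => σ ∉ (Θ x).1).card

section Generic

variable {J J' : Type*}

/-- Balancedness as a count: `2 · #{x ∈ T | σ ∈ Θ_x} = #T` for all `σ`. [cite: Hazama2003GHCCM, (4.1) p. 631] -/
theorem isBalancedOn_iff_two_mul (Θ : J → CMType L) (T : Finset J) :
    IsBalancedOn Θ T ↔ ∀ σ : L →+* ℂ, 2 * (T.filter fun x => σ ∈ (Θ x).1).card = T.card := by
  refine forall_congr' fun σ => ?_
  have h := Finset.card_filter_add_card_filter_not (s := T) (fun x => σ ∈ (Θ x).1)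
  constructor
  · intro h1; omega
  · intro h1; omega

/-- Balancedness as a sum of indicators: `2 · Σ_{x ∈ T} [σ ∈ Θ_x] = #T`. [cite: Hazama2003GHCCM, (4.1) p. 631] -/
theorem isBalancedOn_iff_sum (Θ : J → CMType L) (T : Finset J) :
    IsBalancedOn Θ T ↔ ∀ σ : L →+* ℂ, 2 * (∑ x ∈ T, if σ ∈ (Θ x).1 then 1 else 0) = T.card := by
  rw [isBalancedOn_iff_two_mul]
  refine forall_congr' fun σ => ?_
  rw [Finset.card_filter]

/-- The empty family is balanced (`P = ∅` satisfies (4.1)). [cite: Hazama2003GHCCM, (4.C)/(4.1) p. 631] -/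
theorem isBalancedOn_empty (Θ : J → CMType L) : IsBalancedOn Θ ∅ := fun σ => by simp

/-- Balancedness (4.1) depends only on the types on `T`. [cite: Hazama2003GHCCM, (4.C)/(4.1) p. 631] -/
theorem isBalancedOn_congr {Θ Θ₁ : J → CMType L} {T : Finset J} (h : ∀ x ∈ T, Θ x = Θ₁ x) :
    IsBalancedOn Θ T ↔ IsBalancedOn Θ₁ T := by
  have h1 : ∀ σ : L →+* ℂ, (T.filter fun x => σ ∈ (Θ x).1) = T.filter fun x => σ ∈ (Θ₁ x).1 :=
    fun σ => Finset.filter_congr fun x hx => by rw [h x hx]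
  have h2 : ∀ σ : L →+* ℂ, (T.filter fun x => σ ∉ (Θ x).1) = T.filter fun x => σ ∉ (Θ₁ x).1 :=
    fun σ => Finset.filter_congr fun x hx => by rw [h x hx]
  simp only [IsBalancedOn, h1, h2]

/-- Balancedness (4.1) is transported along a type-preserving injection of index sets. [cite: Hazama2003GHCCM, (4.C)/(4.1) p. 631] -/
theorem isBalancedOn_map_iff {Θ : J → CMType L} {Θ' : J' → CMType L} (ρ : J ↪ J')
    (hρ : ∀ x, Θ' (ρ x) = Θ x) (T : Finset J) : IsBalancedOn Θ' (T.map ρ) ↔ IsBalancedOn Θ T := by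
  refine forall_congr' fun σ => ?_
  rw [Finset.filter_map, Finset.filter_map, Finset.card_map, Finset.card_map]
  have h1 : (T.filter ((fun x => σ ∈ (Θ' x).1) ∘ ρ)) = T.filter fun x => σ ∈ (Θ x).1 :=
    Finset.filter_congr fun x _ => by simp [hρ x]
  have h2 : (T.filter ((fun x => σ ∉ (Θ' x).1) ∘ ρ)) = T.filter fun x => σ ∉ (Θ x).1 :=
    Finset.filter_congr fun x _ => by simp [hρ x]
  rw [h1, h2]

/-- A disjoint union of balanced sub-families is balanced (the kernel of the Hodge matrix is a lattice).
[cite: Hazama2003GHCCM, (4.C)/(4.1) p. 631] [cite: Hazama2003GHCCM, Thm. 7.13 p. 650] -/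
theorem IsBalancedOn.disjUnion {Θ : J → CMType L} {T U : Finset J} (hT : IsBalancedOn Θ T)
    (hU : IsBalancedOn Θ U) (h : Disjoint T U) : IsBalancedOn Θ (T.disjUnion U h) := fun σ => by
  rw [Finset.filter_disjUnion, Finset.filter_disjUnion, Finset.card_disjUnion, Finset.card_disjUnion, hT σ, hU σ]

/-- The family of complements `Θ̄` is balanced where `Θ` is (condition (4.1) is symmetric in `S₁`, `S₁ρ`). [cite: Hazama2003GHCCM, (4.C)/(4.1) p. 631] -/
theorem isBalancedOn_bar {Θ : J → CMType L} {T : Finset J} (hT : IsBalancedOn Θ T) :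
    IsBalancedOn (fun x => CMTypeOps.bar (Θ x)) T := fun σ => by
  have h1 : (T.filter fun x => σ ∈ (CMTypeOps.bar (Θ x)).1) = T.filter fun x => σ ∉ (Θ x).1 :=
    Finset.filter_congr fun x _ => by rw [CMTypeOps.mem_bar_iff]
  have h2 : (T.filter fun x => σ ∉ (CMTypeOps.bar (Θ x)).1) = T.filter fun x => σ ∈ (Θ x).1 :=
    Finset.filter_congr fun x _ => by rw [CMTypeOps.mem_bar_iff, not_not]
  rw [h1, h2, hT σ]

/-- A complementary pair `{Θ_a, Θ_b = Θ̄_a}` is balanced. [cite: Hazama2003GHCCM, Thm. 7.13 (the vectors `d_a`)] -/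
theorem isBalancedOn_pair_of_bar [DecidableEq J] {Θ : J → CMType L} {a b : J} (hab : a ≠ b)
    (h : Θ b = bar (Θ a)) :
    IsBalancedOn Θ {a, b} := by
  rw [isBalancedOn_iff_sum]
  intro σ
  rw [Finset.sum_pair hab, Finset.card_pair hab, h, CMTypeOps.mem_bar_iff]
  by_cases hσ : σ ∈ (Θ a).1 <;> simp [hσ]

/-- A `4`-element family in which every embedding lies in exactly two of the four types is balanced.
[cite: Hazama2003GHCCM, Lemma 7.12 (the vectors `z_{ij}`)] -/
theorem isBalancedOn_of_four [DecidableEq J] {Θ : J → CMType L} {a b c d : J} (hab : a ≠ b) (hac : a ≠ c) (had : a ≠ d)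
    (hbc : b ≠ c) (hbd : b ≠ d) (hcd : c ≠ d)
    (h : ∀ σ : L →+* ℂ, (if σ ∈ (Θ a).1 then 1 else 0) + (if σ ∈ (Θ b).1 then 1 else 0) +
      (if σ ∈ (Θ c).1 then 1 else 0) + (if σ ∈ (Θ d).1 then 1 else 0) = 2) :
    IsBalancedOn Θ {a, b, c, d} := by
  rw [isBalancedOn_iff_sum]
  intro σ
  have hcard : ({a, b, c, d} : Finset J).card = 4 := by
    rw [Finset.card_insert_of_notMem (by simp [hab, hac, had]), Finset.card_insert_of_notMem (by simp [hbc, hbd]),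
      Finset.card_pair hcd]
  rw [hcard, Finset.sum_insert (by simp [hab, hac, had]), Finset.sum_insert (by simp [hbc, hbd]),
    Finset.sum_pair hcd, ← add_assoc, ← add_assoc, h σ]

/-! ### Block unions -/

/-- **`T` is a disjoint union of balanced blocks of size `2` or `4`** of the family `Θ` — the index-set form of
"a product of Hodge classes of codimension `≤ 2`" (mass `2`: divisor classes, Hazama's `d_a`; mass `4`: codimension-`2`
classes, Hazama's `z_{ij}`). [cite: Hazama2003GHCCM, Thm. 7.13–7.14 p. 650] [cite: Milne2007TateFiniteFieldsAIM, Thm. 8.3] -/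
inductive IsBlockUnion (Θ : J → CMType L) : Finset J → Prop
  | empty : IsBlockUnion Θ ∅
  | cons {B T : Finset J} (hT : IsBlockUnion Θ T) (hdisj : Disjoint B T) (hcard : B.card = 2 ∨ B.card = 4)
      (hbal : IsBalancedOn Θ B) : IsBlockUnion Θ (B.disjUnion T hdisj)

/-- Transport of a block union along an equality of index sets. [cite: Hazama2003GHCCM, Thm. 7.13–7.14 p. 650] -/
theorem IsBlockUnion.of_eq {Θ : J → CMType L} {T T' : Finset J} (hT : IsBlockUnion Θ T) (h : T = T') :
    IsBlockUnion Θ T' := h ▸ hT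

/-- A block union depends only on the types on `T`. [cite: Hazama2003GHCCM, Thm. 7.13–7.14 p. 650] -/
theorem IsBlockUnion.congr {Θ Θ₁ : J → CMType L} {T : Finset J} (hT : IsBlockUnion Θ T)
    (h : ∀ x ∈ T, Θ x = Θ₁ x) : IsBlockUnion Θ₁ T := by
  induction hT with
  | empty => exact IsBlockUnion.empty
  | @cons B T hT hdisj hcard hbal ih =>
    have hB : ∀ x ∈ B, Θ x = Θ₁ x := fun x hx => h x (Finset.mem_disjUnion.2 (Or.inl hx))
    have hT' : ∀ x ∈ T, Θ x = Θ₁ x := fun x hx => h x (Finset.mem_disjUnion.2 (Or.inr hx))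
    exact IsBlockUnion.cons (ih hT') hdisj hcard ((isBalancedOn_congr hB).1 hbal)

/-- A block union is transported along a type-preserving injection of index sets. [cite: Hazama2003GHCCM, Thm. 7.13–7.14 p. 650] -/
theorem IsBlockUnion.map {Θ : J → CMType L} {Θ' : J' → CMType L} (ρ : J ↪ J') (hρ : ∀ x, Θ' (ρ x) = Θ x)
    {T : Finset J} (hT : IsBlockUnion Θ T) : IsBlockUnion Θ' (T.map ρ) := by
  induction hT with
  | empty => rw [Finset.map_empty]; exact IsBlockUnion.empty
  | @cons B T hT hdisj hcard hbal ih =>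
    have hdisj' : Disjoint (B.map ρ) (T.map ρ) := (Finset.disjoint_map ρ).2 hdisj
    rw [Finset.map_disjUnion B T hdisj]
    refine IsBlockUnion.cons ih hdisj' ?_ ((isBalancedOn_map_iff ρ hρ B).2 hbal)
    rw [Finset.card_map]; exact hcard

/-- A block union is balanced (sums of kernel vectors are kernel vectors). [cite: Hazama2003GHCCM, Thm. 7.13–7.14 p. 650] -/
theorem IsBlockUnion.isBalancedOn {Θ : J → CMType L} {T : Finset J} (hT : IsBlockUnion Θ T) : IsBalancedOn Θ T := by
  induction hT with
  | empty => exact isBalancedOn_empty Θ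
  | @cons B T hT hdisj hcard hbal ih => exact hbal.disjUnion ih hdisj

/-- Two disjoint block unions form a block union. [cite: Hazama2003GHCCM, Thm. 7.13–7.14 p. 650] -/
theorem IsBlockUnion.disjUnion {Θ : J → CMType L} {T U : Finset J} (hT : IsBlockUnion Θ T) (hU : IsBlockUnion Θ U)
    (h : Disjoint T U) : IsBlockUnion Θ (T.disjUnion U h) := by
  induction hT generalizing U with
  | empty => exact hU.of_eq (by ext; simp)
  | @cons B T hT hdisj hcard hbal ih =>
    have hTU : Disjoint T U := Finset.disjoint_of_subset_left (fun x hx => Finset.mem_disjUnion.2 (Or.inr hx)) h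
    have hBU : Disjoint B U := Finset.disjoint_of_subset_left (fun x hx => Finset.mem_disjUnion.2 (Or.inl hx)) h
    have hB' : Disjoint B (T.disjUnion U hTU) := by
      rw [Finset.disjoint_disjUnion_right]; exact ⟨hdisj, hBU⟩
    exact (IsBlockUnion.cons (ih hU hTU) hB' hcard hbal).of_eq (by ext; simp)

/-- A single balanced block of size `2` or `4` (a `d_a` or a `z_{ij}`) is a block union. [cite: Hazama2003GHCCM, Thm. 7.13–7.14 p. 650] -/
theorem isBlockUnion_single {Θ : J → CMType L} {B : Finset J} (hcard : B.card = 2 ∨ B.card = 4)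
    (hbal : IsBalancedOn Θ B) : IsBlockUnion Θ B :=
  (IsBlockUnion.cons IsBlockUnion.empty (Finset.disjoint_empty_right B) hcard hbal).of_eq
    (by ext; simp)

/-- The family of complements of a block union is a block union (balancedness of a block is symmetric in `∈ / ∉`).
[cite: Hazama2003GHCCM, Thm. 7.13–7.14 p. 650] -/
theorem isBlockUnion_bar {Θ : J → CMType L} {T : Finset J} (hT : IsBlockUnion Θ T) :
    IsBlockUnion (fun x => CMTypeOps.bar (Θ x)) T := by
  induction hT with
  | empty => exact IsBlockUnion.empty
  | @cons B T hT hdisj hcard hbal ih => exact IsBlockUnion.cons ih hdisj hcard (isBalancedOn_bar hbal)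

/-- Balancedness is preserved when every type is replaced by its INDUCED type along one ring endomorphism
`κ : L → L` (`Φ ↦ {σ | σ ∘ κ ∈ Φ}`): condition (4.1) at `σ` for the induced family is condition (4.1) at `σ ∘ κ`.
[cite: Hazama2003GHCCM, (4.C)/(4.1) p. 631] [cite: Streng2010, Ch. I Def. 3.2] -/
theorem IsBalancedOn.induced {Θ : J → CMType L} {T : Finset J} (hT : IsBalancedOn Θ T) (κ : L →+* L) :
    IsBalancedOn (fun x => Literature.NumberTheory.ComplexMultiplication.inducedCMType κ (Θ x)) T := fun σ => by
  have h1 : (T.filter fun x => σ ∈ (Literature.NumberTheory.ComplexMultiplication.inducedCMType κ (Θ x)).1) =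
      T.filter fun x => σ.comp κ ∈ (Θ x).1 := Finset.filter_congr fun x _ => by
    rw [Literature.NumberTheory.ComplexMultiplication.mem_inducedCMType_iff]
  have h2 : (T.filter fun x => σ ∉ (Literature.NumberTheory.ComplexMultiplication.inducedCMType κ (Θ x)).1) =
      T.filter fun x => σ.comp κ ∉ (Θ x).1 := Finset.filter_congr fun x _ => by
    rw [Literature.NumberTheory.ComplexMultiplication.mem_inducedCMType_iff]
  rw [h1, h2]
  exact hT (σ.comp κ)

/-- A block union stays a block union when every type is replaced by its induced type along one ring endomorphism
of `L`. [cite: Hazama2003GHCCM, Thm. 7.13–7.14 p. 650] [cite: Streng2010, Ch. I Def. 3.2] -/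
theorem IsBlockUnion.induced {Θ : J → CMType L} {T : Finset J} (hT : IsBlockUnion Θ T) (κ : L →+* L) :
    IsBlockUnion (fun x => Literature.NumberTheory.ComplexMultiplication.inducedCMType κ (Θ x)) T := by
  induction hT with
  | empty => exact IsBlockUnion.empty
  | @cons B T hT hdisj hcard hbal ih => exact IsBlockUnion.cons ih hdisj hcard (hbal.induced κ)

/-! ### The flip move -/

section Flip

variable {Θ : J → CMType L}

/-- Off the place of `p`, flipping at `p` does not change membership. [folklore] -/
private theorem mem_flip_iff_of_notMem_placeSet {p σ : L →+* ℂ} (Φ : CMType L) (hσ : σ ∉ placeSet p) :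
    σ ∈ (flip p Φ).1 ↔ σ ∈ Φ.1 := by
  rw [CMTypeOps.mem_flip_iff]; tauto

/-- On the place of `p`, flipping at `p` reverses membership. [folklore] -/
private theorem mem_flip_iff_of_mem_placeSet {p σ : L →+* ℂ} (Φ : CMType L) (hσ : σ ∈ placeSet p) :
    σ ∈ (flip p Φ).1 ↔ σ ∉ Φ.1 := by
  rw [CMTypeOps.mem_flip_iff]; tauto

/-- The place of `p` is `{p, p̄}`. [folklore] -/
private theorem mem_placeSet_iff {p σ : L →+* ℂ} : σ ∈ placeSet p ↔ σ = p ∨ σ = conjugate p := by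
  simp [CMTypeOps.placeSet]

/-- A member of a CM type is not its own conjugate. [folklore] -/
private theorem conjugate_ne_of_mem {Φ : CMType L} {p : L →+* ℂ} (hp : p ∈ Φ.1) : conjugate p ≠ p := fun h => by
  have h1 := (CMTypeOps.mem_iff_conjugate_notMem Φ p).1 hp
  rw [h] at h1
  exact h1 hp

end Flip

end Generic

/-! ### The decomposition theorem -/

section Main

variable [NumberField L] {J : Type}

/-- The disorder of `Θ` relative to `H` at `x`: `#(Θ_x ∆ H_x)`. [folklore] -/
private def dis (Θ H : J → CMType L) (x : J) : ℕ :=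
  (Finset.univ.filter fun σ : L →+* ℂ => ¬ (σ ∈ (Θ x).1 ↔ σ ∈ (H x).1)).card

/-- The total disorder `Σ_x #(Θ_x ∆ H_x)`. [folklore] -/
private def disorder [Fintype J] (Θ H : J → CMType L) : ℕ := ∑ x, dis Θ H x

/-- Zero disorder at `x` means `Θ_x = H_x`. [folklore] -/
private theorem eq_of_dis_eq_zero {Θ H : J → CMType L} {x : J} (h : dis Θ H x = 0) : Θ x = H x := by
  rw [dis, Finset.card_eq_zero, Finset.filter_eq_empty_iff] at h
  exact Subtype.ext (Set.ext fun σ => not_not.1 (h (Finset.mem_univ σ)))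

/-- Counting lemma for the flip at one place: if `Q` agrees with `P` off `{s, t}` (`s ≠ t`) while `P s`, `P t` hold and
`Q s`, `Q t` fail, then `#Q + 2 = #P`. [folklore] -/
private theorem card_filter_add_two {α : Type*} [Fintype α] {P Q : α → Prop} [DecidablePred P] [DecidablePred Q]
    {s t : α} (hst : s ≠ t)
    (hPs : P s) (hPt : P t) (hQs : ¬ Q s) (hQt : ¬ Q t) (h : ∀ a, a ≠ s → a ≠ t → (Q a ↔ P a)) :
    (Finset.univ.filter Q).card + 2 = (Finset.univ.filter P).card := by
  have heq : Finset.univ.filter P = (Finset.univ.filter Q).disjUnion {s, t} (by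
      rw [Finset.disjoint_insert_right, Finset.disjoint_singleton_right, Finset.mem_filter, Finset.mem_filter]
      exact ⟨fun h => hQs h.2, fun h => hQt h.2⟩) := by
    ext a
    simp only [Finset.mem_filter, Finset.mem_univ, true_and, Finset.mem_disjUnion, Finset.mem_insert,
      Finset.mem_singleton]
    by_cases has : a = s
    · subst has; simp [hPs]
    · by_cases hat : a = t
      · subst hat; simp [hPt]
      · rw [h a has hat]; simp [has, hat]
  rw [heq, Finset.card_disjUnion, Finset.card_pair hst]

/-- The index embedding of the induction step: `x ↦ a`, `x' ↦ b` (the two flipped rows move to the new slots carrying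
their flipped types), every other old index and every old new-slot stays. [folklore] -/
private def stepMap [DecidableEq J] {k : ℕ} (x x' : J) : J ⊕ Fin k → J ⊕ Fin (k + 4) := fun z =>
  match z with
  | Sum.inl z => if z = x then Sum.inr (Fin.natAdd k 0) else if z = x' then Sum.inr (Fin.natAdd k 2) else Sum.inl z
  | Sum.inr y => Sum.inr (Fin.castAdd 4 y)

/-- `x ↦ a`. [folklore] -/
private theorem stepMap_inl_left [DecidableEq J] {k : ℕ} (x x' : J) : stepMap (k := k) x x' (Sum.inl x) = Sum.inr (Fin.natAdd k 0) := by
  simp [stepMap]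

/-- `x' ↦ b`. [folklore] -/
private theorem stepMap_inl_right [DecidableEq J] {k : ℕ} {x x' : J} (hxx' : x ≠ x') :
    stepMap (k := k) x x' (Sum.inl x') = Sum.inr (Fin.natAdd k 2) := by
  simp [stepMap, hxx'.symm]

/-- The other old rows stay. [folklore] -/
private theorem stepMap_inl_of_ne [DecidableEq J] {k : ℕ} {x x' z : J} (hz : z ≠ x) (hz' : z ≠ x') :
    stepMap (k := k) x x' (Sum.inl z) = Sum.inl z := by
  simp [stepMap, hz, hz']

/-- The old new-slots stay. [folklore] -/
private theorem stepMap_inr [DecidableEq J] {k : ℕ} (x x' : J) (y : Fin k) :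
    stepMap (k := k) x x' (Sum.inr y) = Sum.inr (Fin.castAdd 4 y) := rfl

/-- The step map is injective (a left inverse). [folklore] -/
private theorem stepMap_injective [DecidableEq J] {k : ℕ} {x x' : J} (hxx' : x ≠ x') : Function.Injective (stepMap (k := k) x x') := by
  -- a left inverse
  let g : J ⊕ Fin (k + 4) → J ⊕ Fin k := fun w =>
    match w with
    | Sum.inl z => Sum.inl z
    | Sum.inr w => if (w : ℕ) < k then (if h : (w : ℕ) < k then Sum.inr ⟨w, h⟩ else Sum.inl x)
        else if (w : ℕ) = k then Sum.inl x else Sum.inl x'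
  refine Function.LeftInverse.injective (g := g) fun z => ?_
  rcases z with z | y
  · by_cases hz : z = x
    · subst hz; rw [stepMap_inl_left]; simp [g]
    · by_cases hz' : z = x'
      · subst hz'; rw [stepMap_inl_right hxx']; simp [g]
      · rw [stepMap_inl_of_ne hz hz']
  · rw [stepMap_inr]; simp [g]

variable [Fintype J] [DecidableEq J]

omit [NumberField L] in
/-- **The flip move preserves balancedness of the whole family**: flipping `Θ_x` and `Θ_{x'}` at the place of an
embedding `σ₀` lying in exactly one of them. [cite: Hazama2003GHCCM, Lemma 7.12] -/
private theorem isBalancedOn_univ_flip {Θ : J → CMType L} (hΘ : IsBalancedOn Θ Finset.univ) {x x' : J} (hxx' : x ≠ x')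
    {σ₀ : L →+* ℂ} (hx : σ₀ ∈ (Θ x).1) (hx' : σ₀ ∉ (Θ x').1) :
    IsBalancedOn (Function.update (Function.update Θ x (flip σ₀ (Θ x))) x' (flip σ₀ (Θ x'))) Finset.univ := by
  set Θ₁ := Function.update (Function.update Θ x (flip σ₀ (Θ x))) x' (flip σ₀ (Θ x')) with hΘ₁
  have hΘ₁x : Θ₁ x = flip σ₀ (Θ x) := by
    rw [hΘ₁, Function.update_of_ne hxx', Function.update_self]
  have hΘ₁x' : Θ₁ x' = flip σ₀ (Θ x') := by rw [hΘ₁, Function.update_self]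
  have hΘ₁z : ∀ z, z ≠ x → z ≠ x' → Θ₁ z = Θ z := fun z hz hz' => by
    rw [hΘ₁, Function.update_of_ne hz', Function.update_of_ne hz]
  rw [isBalancedOn_iff_sum] at hΘ ⊢
  intro σ
  rw [← hΘ σ]
  congr 1
  -- split off `x` and `x'` from both sums
  have hx'mem : x' ∈ (Finset.univ : Finset J).erase x := Finset.mem_erase.2 ⟨hxx'.symm, Finset.mem_univ _⟩
  rw [← Finset.add_sum_erase _ _ (Finset.mem_univ x), ← Finset.add_sum_erase _ _ hx'mem,
    ← Finset.add_sum_erase _ _ (Finset.mem_univ x), ← Finset.add_sum_erase _ _ hx'mem, ← add_assoc, ← add_assoc]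
  have hrest : ∑ z ∈ ((Finset.univ : Finset J).erase x).erase x', (if σ ∈ (Θ₁ z).1 then 1 else 0) =
      ∑ z ∈ ((Finset.univ : Finset J).erase x).erase x', (if σ ∈ (Θ z).1 then 1 else 0) := by
    refine Finset.sum_congr rfl fun z hz => ?_
    rw [Finset.mem_erase, Finset.mem_erase] at hz
    rw [hΘ₁z z hz.2.1 hz.1]
  rw [hrest, hΘ₁x, hΘ₁x']
  congr 1
  by_cases hσ : σ ∈ placeSet σ₀
  · simp only [mem_flip_iff_of_mem_placeSet _ hσ]
    rcases mem_placeSet_iff.1 hσ with rfl | rfl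
    · simp [hx, hx']
    · have h1 : conjugate σ₀ ∉ (Θ x).1 := (CMTypeOps.mem_iff_conjugate_notMem _ _).1 hx
      have h2 : conjugate σ₀ ∈ (Θ x').1 := (CMTypeOps.conjugate_mem_iff_notMem _ _).2 hx'
      simp [h1, h2]
  · simp only [mem_flip_iff_of_notMem_placeSet _ hσ]

/-- **The flip move lowers the disorder by `4`** when `σ₀ ∈ Θ_x ∖ H_x` and `σ₀ ∈ H_{x'} ∖ Θ_{x'}`. [folklore] -/
private theorem disorder_flip {Θ H : J → CMType L} {x x' : J} (hxx' : x ≠ x') {σ₀ : L →+* ℂ}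
    (hx : σ₀ ∈ (Θ x).1) (hHx : σ₀ ∉ (H x).1) (hx' : σ₀ ∉ (Θ x').1) (hHx' : σ₀ ∈ (H x').1) :
    disorder (Function.update (Function.update Θ x (flip σ₀ (Θ x))) x' (flip σ₀ (Θ x'))) H + 4 = disorder Θ H := by
  set Θ₁ := Function.update (Function.update Θ x (flip σ₀ (Θ x))) x' (flip σ₀ (Θ x')) with hΘ₁
  have hΘ₁x : Θ₁ x = flip σ₀ (Θ x) := by
    rw [hΘ₁, Function.update_of_ne hxx', Function.update_self]
  have hΘ₁x' : Θ₁ x' = flip σ₀ (Θ x') := by rw [hΘ₁, Function.update_self]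
  have hΘ₁z : ∀ z, z ≠ x → z ≠ x' → Θ₁ z = Θ z := fun z hz hz' => by
    rw [hΘ₁, Function.update_of_ne hz', Function.update_of_ne hz]
  have hne : conjugate σ₀ ≠ σ₀ := conjugate_ne_of_mem hx
  -- at `x`
  have hdx : dis Θ₁ H x + 2 = dis Θ H x := by
    unfold dis
    refine card_filter_add_two hne.symm ?_ ?_ ?_ ?_ fun σ hσ hσ' => ?_
    · simp [hx, hHx]
    · have h1 : conjugate σ₀ ∉ (Θ x).1 := (CMTypeOps.mem_iff_conjugate_notMem _ _).1 hx
      have h2 : conjugate σ₀ ∈ (H x).1 := (CMTypeOps.conjugate_mem_iff_notMem _ _).2 hHx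
      simp [h1, h2]
    · rw [hΘ₁x, mem_flip_iff_of_mem_placeSet _ (mem_placeSet_iff.2 (Or.inl rfl))]; simp [hx, hHx]
    · have h1 : conjugate σ₀ ∉ (Θ x).1 := (CMTypeOps.mem_iff_conjugate_notMem _ _).1 hx
      have h2 : conjugate σ₀ ∈ (H x).1 := (CMTypeOps.conjugate_mem_iff_notMem _ _).2 hHx
      rw [hΘ₁x, mem_flip_iff_of_mem_placeSet _ (mem_placeSet_iff.2 (Or.inr rfl))]; simp [h1, h2]
    · have hσp : σ ∉ placeSet σ₀ := fun h => by
        rcases mem_placeSet_iff.1 h with rfl | rfl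
        · exact hσ rfl
        · exact hσ' rfl
      rw [hΘ₁x, mem_flip_iff_of_notMem_placeSet _ hσp]
  -- at `x'`
  have hdx' : dis Θ₁ H x' + 2 = dis Θ H x' := by
    unfold dis
    refine card_filter_add_two hne.symm ?_ ?_ ?_ ?_ fun σ hσ hσ' => ?_
    · simp [hx', hHx']
    · have h1 : conjugate σ₀ ∈ (Θ x').1 := (CMTypeOps.conjugate_mem_iff_notMem _ _).2 hx'
      have h2 : conjugate σ₀ ∉ (H x').1 := (CMTypeOps.mem_iff_conjugate_notMem _ _).1 hHx'
      simp [h1, h2]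
    · rw [hΘ₁x', mem_flip_iff_of_mem_placeSet _ (mem_placeSet_iff.2 (Or.inl rfl))]; simp [hx', hHx']
    · have h1 : conjugate σ₀ ∈ (Θ x').1 := (CMTypeOps.conjugate_mem_iff_notMem _ _).2 hx'
      have h2 : conjugate σ₀ ∉ (H x').1 := (CMTypeOps.mem_iff_conjugate_notMem _ _).1 hHx'
      rw [hΘ₁x', mem_flip_iff_of_mem_placeSet _ (mem_placeSet_iff.2 (Or.inr rfl))]; simp [h1, h2]
    · have hσp : σ ∉ placeSet σ₀ := fun h => by
        rcases mem_placeSet_iff.1 h with rfl | rfl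
        · exact hσ rfl
        · exact hσ' rfl
      rw [hΘ₁x', mem_flip_iff_of_notMem_placeSet _ hσp]
  -- elsewhere
  have hdz : ∀ z, z ≠ x → z ≠ x' → dis Θ₁ H z = dis Θ H z := fun z hz hz' => by
    simp only [dis, hΘ₁z z hz hz']
  have hx'mem : x' ∈ (Finset.univ : Finset J).erase x := Finset.mem_erase.2 ⟨hxx'.symm, Finset.mem_univ _⟩
  rw [disorder, disorder, ← Finset.add_sum_erase _ _ (Finset.mem_univ x), ← Finset.add_sum_erase _ _ hx'mem,
    ← Finset.add_sum_erase _ (dis Θ H) (Finset.mem_univ x), ← Finset.add_sum_erase _ (dis Θ H) hx'mem,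
    Finset.sum_congr rfl fun z hz => hdz z (Finset.mem_erase.1 (Finset.mem_of_mem_erase hz)).1
      (Finset.mem_erase.1 hz).1, ← hdx, ← hdx']
  ring

omit [NumberField L] [DecidableEq J] in
/-- Pigeonhole for the partner of the flip move: if `Θ` and `H` are both balanced on all of `J` and `σ₀ ∈ Θ_x ∖ H_x`,
some `x'` has `σ₀ ∈ H_{x'} ∖ Θ_{x'}`. [folklore] -/
private theorem exists_partner {Θ H : J → CMType L} (hΘ : IsBalancedOn Θ Finset.univ) (hH : IsBalancedOn H Finset.univ)
    {x : J} {σ₀ : L →+* ℂ} (hx : σ₀ ∈ (Θ x).1) (hHx : σ₀ ∉ (H x).1) :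
    ∃ x', σ₀ ∉ (Θ x').1 ∧ σ₀ ∈ (H x').1 := by
  by_contra hall
  push Not at hall
  have hsub : (Finset.univ.filter fun z => σ₀ ∈ (H z).1) ⊆ Finset.univ.filter fun z => σ₀ ∈ (Θ z).1 := by
    intro z hz
    rw [Finset.mem_filter] at hz ⊢
    exact ⟨hz.1, by_contra fun h => hall z h hz.2⟩
  have hcard : (Finset.univ.filter fun z => σ₀ ∈ (Θ z).1).card = (Finset.univ.filter fun z => σ₀ ∈ (H z).1).card := by
    have h1 := (isBalancedOn_iff_two_mul Θ _).1 hΘ σ₀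
    have h2 := (isBalancedOn_iff_two_mul H _).1 hH σ₀
    omega
  have heq := Finset.eq_of_subset_of_card_le hsub hcard.le
  have hxmem : x ∈ Finset.univ.filter fun z => σ₀ ∈ (Θ z).1 := Finset.mem_filter.2 ⟨Finset.mem_univ _, hx⟩
  rw [← heq, Finset.mem_filter] at hxmem
  exact hHx hxmem.2

/-- **The decomposition theorem, inductive form** (on the disorder relative to a balanced block union `H`).
[cite: Hazama2003GHCCM, Thm. 7.14 and Remark 7.15 p. 650] [cite: Milne2007TateFiniteFieldsAIM, Thm. 8.3] -/
private theorem exists_isBlockUnion_aux (H : J → CMType L) (hH : IsBlockUnion H Finset.univ) :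
    ∀ (D : ℕ) (Θ : J → CMType L), IsBalancedOn Θ Finset.univ → disorder Θ H ≤ D →
      ∃ (k : ℕ) (Θ' : Fin k → CMType L), IsBlockUnion Θ' Finset.univ ∧ IsBlockUnion (Sum.elim Θ Θ') Finset.univ := by
  intro D
  induction D using Nat.strong_induction_on with
  | _ D ih =>
  intro Θ hΘ hD
  by_cases h0 : disorder Θ H = 0
  · -- `Θ = H`: no new types
    have hΘH : ∀ x, Θ x = H x := fun x =>
      eq_of_dis_eq_zero ((Finset.sum_eq_zero_iff.1 h0) x (Finset.mem_univ x))
    refine ⟨0, Fin.elim0, IsBlockUnion.empty.of_eq (Finset.univ_eq_empty).symm, ?_⟩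
    have h1 : (Finset.univ : Finset (J ⊕ Fin 0)) = (Finset.univ : Finset J).map Function.Embedding.inl := by
      ext z; rcases z with z | y
      · simp
      · exact Fin.elim0 y
    rw [h1]
    exact (hH.congr fun x _ => (hΘH x).symm).map Function.Embedding.inl fun x => rfl
  · -- a disagreement `σ₀ ∈ Θ_x ∖ H_x`
    obtain ⟨x, hxd⟩ : ∃ x, dis Θ H x ≠ 0 := by
      by_contra hall; push Not at hall
      exact h0 (Finset.sum_eq_zero fun x _ => hall x)
    obtain ⟨σ₁, hσ₁⟩ : ∃ σ, ¬ (σ ∈ (Θ x).1 ↔ σ ∈ (H x).1) := by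
      by_contra hall; push Not at hall
      exact hxd (Finset.card_eq_zero.2 (Finset.filter_eq_empty_iff.2 fun σ _ => not_not_intro (hall σ)))
    obtain ⟨σ₀, hx, hHx⟩ : ∃ σ₀, σ₀ ∈ (Θ x).1 ∧ σ₀ ∉ (H x).1 := by
      by_cases hσx : σ₁ ∈ (Θ x).1
      · exact ⟨σ₁, hσx, fun h => hσ₁ ⟨fun _ => h, fun _ => hσx⟩⟩
      · have hσH : σ₁ ∈ (H x).1 := by
          by_contra h; exact hσ₁ ⟨fun h' => absurd h' hσx, fun h' => absurd h' h⟩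
        exact ⟨conjugate σ₁, (CMTypeOps.conjugate_mem_iff_notMem _ _).2 hσx,
          (CMTypeOps.mem_iff_conjugate_notMem _ _).1 hσH⟩
    obtain ⟨x', hx', hHx'⟩ := exists_partner hΘ hH.isBalancedOn hx hHx
    have hxx' : x ≠ x' := by rintro rfl; exact hx' hx
    -- the flipped family
    set Θ₁ := Function.update (Function.update Θ x (flip σ₀ (Θ x))) x' (flip σ₀ (Θ x')) with hΘ₁
    have hΘ₁x : Θ₁ x = flip σ₀ (Θ x) := by
      rw [hΘ₁, Function.update_of_ne hxx', Function.update_self]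
    have hΘ₁x' : Θ₁ x' = flip σ₀ (Θ x') := by rw [hΘ₁, Function.update_self]
    have hΘ₁z : ∀ z, z ≠ x → z ≠ x' → Θ₁ z = Θ z := fun z hz hz' => by
      rw [hΘ₁, Function.update_of_ne hz', Function.update_of_ne hz]
    have hbal₁ : IsBalancedOn Θ₁ Finset.univ := isBalancedOn_univ_flip hΘ hxx' hx hx'
    have hdis₁ : disorder Θ₁ H + 4 = disorder Θ H := disorder_flip hxx' hx hHx hx' hHx'
    obtain ⟨k, Θ', hB1, hB2⟩ := ih (disorder Θ₁ H) (by omega) Θ₁ hbal₁ le_rfl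
    -- the four new types `a, ā, b, b̄`
    let a : CMType L := flip σ₀ (Θ x)
    let b : CMType L := flip σ₀ (Θ x')
    let ν : Fin 4 → CMType L := ![a, bar a, b, bar b]
    refine ⟨k + 4, Fin.append Θ' ν, ?_, ?_⟩
    · -- `Θ' ⊔ ν` is a block union: the old blocks, then the two complementary pairs
      have hold : IsBlockUnion (Fin.append Θ' ν) ((Finset.univ : Finset (Fin k)).map (Fin.castAddEmb 4)) :=
        hB1.map (Fin.castAddEmb 4) fun y => Fin.append_left Θ' ν y
      have hp1 : IsBlockUnion (Fin.append Θ' ν) {Fin.natAdd k 0, Fin.natAdd k 1} := by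
        refine isBlockUnion_single (Or.inl (Finset.card_pair (by simp [Fin.ext_iff]))) (isBalancedOn_pair_of_bar ?_ ?_)
        · simp [Fin.ext_iff]
        · rw [Fin.append_right, Fin.append_right]; rfl
      have hp2 : IsBlockUnion (Fin.append Θ' ν) {Fin.natAdd k 2, Fin.natAdd k 3} := by
        refine isBlockUnion_single (Or.inl (Finset.card_pair (by simp [Fin.ext_iff]))) (isBalancedOn_pair_of_bar ?_ ?_)
        · simp [Fin.ext_iff]
        · rw [Fin.append_right, Fin.append_right]; rfl
      have hd12 : Disjoint ({Fin.natAdd k 0, Fin.natAdd k 1} : Finset (Fin (k + 4))) {Fin.natAdd k 2, Fin.natAdd k 3} := by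
        simp [Fin.ext_iff]
      have hnew := hp1.disjUnion hp2 hd12
      have hd : Disjoint ((Finset.univ : Finset (Fin k)).map (Fin.castAddEmb 4))
          (({Fin.natAdd k 0, Fin.natAdd k 1} : Finset (Fin (k + 4))).disjUnion {Fin.natAdd k 2, Fin.natAdd k 3} hd12) := by
        rw [Finset.disjoint_left]
        intro w hw hw'
        simp only [Finset.mem_map, Finset.mem_univ, true_and, Fin.castAddEmb_apply] at hw
        obtain ⟨y, rfl⟩ := hw
        simp [Fin.ext_iff] at hw'
        omega
      refine (hold.disjUnion hnew hd).of_eq (Finset.eq_univ_of_forall fun w => ?_)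
      induction w using Fin.addCases with
      | left y => exact Finset.mem_disjUnion.2 (Or.inl (Finset.mem_map.2 ⟨y, Finset.mem_univ _, rfl⟩))
      | right j =>
        refine Finset.mem_disjUnion.2 (Or.inr (Finset.mem_disjUnion.2 ?_))
        fin_cases j <;> simp
    · -- the enlarged family: transport the old block union along `stepMap`, then add the block `{x, x', ā, b̄}`
      let ρ : J ⊕ Fin k ↪ J ⊕ Fin (k + 4) := ⟨stepMap x x', stepMap_injective hxx'⟩
      have hν0 : ν 0 = a := rfl
      have hν2 : ν 2 = b := rfl
      have hρ : ∀ z, Sum.elim Θ (Fin.append Θ' ν) (ρ z) = Sum.elim Θ₁ Θ' z := by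
        rintro (z | y)
        · change Sum.elim Θ (Fin.append Θ' ν) (stepMap x x' (Sum.inl z)) = Θ₁ z
          by_cases hz : z = x
          · rw [hz, stepMap_inl_left, Sum.elim_inr, Fin.append_right, hν0, hΘ₁x]
          · by_cases hz' : z = x'
            · rw [hz', stepMap_inl_right hxx', Sum.elim_inr, Fin.append_right, hν2, hΘ₁x']
            · rw [stepMap_inl_of_ne hz hz', Sum.elim_inl, hΘ₁z z hz hz']
        · change Sum.elim Θ (Fin.append Θ' ν) (Sum.inr (Fin.castAdd 4 y)) = Θ' y
          rw [Sum.elim_inr, Fin.append_left]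
      have hold : IsBlockUnion (Sum.elim Θ (Fin.append Θ' ν)) ((Finset.univ : Finset (J ⊕ Fin k)).map ρ) :=
        hB2.map ρ hρ
      -- the new block
      let β : Finset (J ⊕ Fin (k + 4)) :=
        {Sum.inl x, Sum.inl x', Sum.inr (Fin.natAdd k 1), Sum.inr (Fin.natAdd k 3)}
      have hβbal : IsBalancedOn (Sum.elim Θ (Fin.append Θ' ν)) β := by
        refine isBalancedOn_of_four (by simp [hxx']) (by simp) (by simp) (by simp) (by simp) (by simp [Fin.ext_iff])
          fun σ => ?_
        have hν1 : Fin.append Θ' ν (Fin.natAdd k 1) = bar a := by rw [Fin.append_right]; rfl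
        have hν3 : Fin.append Θ' ν (Fin.natAdd k 3) = bar b := by rw [Fin.append_right]; rfl
        simp only [Sum.elim_inl, Sum.elim_inr, hν1, hν3, CMTypeOps.mem_bar_iff, a, b]
        by_cases hσ : σ ∈ placeSet σ₀
        · simp only [mem_flip_iff_of_mem_placeSet _ hσ, not_not]
          rcases mem_placeSet_iff.1 hσ with rfl | rfl
          · simp [hx, hx']
          · have h1 : conjugate σ₀ ∉ (Θ x).1 := (CMTypeOps.mem_iff_conjugate_notMem _ _).1 hx
            have h2 : conjugate σ₀ ∈ (Θ x').1 := (CMTypeOps.conjugate_mem_iff_notMem _ _).2 hx'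
            simp [h1, h2]
        · simp only [mem_flip_iff_of_notMem_placeSet _ hσ]
          by_cases h1 : σ ∈ (Θ x).1 <;> by_cases h2 : σ ∈ (Θ x').1 <;> simp [h1, h2]
      have hβcard : β.card = 4 := by
        simp only [β]
        rw [Finset.card_insert_of_notMem (by simp [hxx']), Finset.card_insert_of_notMem (by simp),
          Finset.card_pair (by simp [Fin.ext_iff])]
      have hβdisj : Disjoint β ((Finset.univ : Finset (J ⊕ Fin k)).map ρ) := by
        rw [Finset.disjoint_right]
        intro w hw
        simp only [Finset.mem_map, Finset.mem_univ, true_and] at hw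
        obtain ⟨z, rfl⟩ := hw
        rcases z with z | y
        · change stepMap x x' (Sum.inl z) ∉ β
          by_cases hz : z = x
          · rw [hz, stepMap_inl_left]; simp [β, Fin.ext_iff]
          · by_cases hz' : z = x'
            · rw [hz', stepMap_inl_right hxx']; simp [β, Fin.ext_iff]
            · rw [stepMap_inl_of_ne hz hz']; simp [β, hz, hz']
        · change Sum.inr (Fin.castAdd 4 y) ∉ β
          simp only [β, Finset.mem_insert, Finset.mem_singleton, Sum.inr.injEq, reduceCtorEq, false_or, Fin.ext_iff,
            Fin.val_castAdd, Fin.val_natAdd]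
          omega
      refine (IsBlockUnion.cons hold hβdisj (Or.inr hβcard) hβbal).of_eq (Finset.eq_univ_of_forall fun w => ?_)
      rw [Finset.mem_disjUnion]
      rcases w with z | w
      · by_cases hz : z = x
        · left; simp [β, hz]
        · by_cases hz' : z = x'
          · left; simp [β, hz']
          · right
            exact Finset.mem_map.2 ⟨Sum.inl z, Finset.mem_univ _, stepMap_inl_of_ne hz hz'⟩
      · induction w using Fin.addCases with
        | left y => right; exact Finset.mem_map.2 ⟨Sum.inr y, Finset.mem_univ _, rfl⟩
        | right j =>
          fin_cases j
          · right
            exact Finset.mem_map.2 ⟨Sum.inl x, Finset.mem_univ _, stepMap_inl_left x x'⟩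
          · left; simp [β]
          · right
            exact Finset.mem_map.2 ⟨Sum.inl x', Finset.mem_univ _, stepMap_inl_right hxx'⟩
          · left; simp [β]

omit [Fintype J] [DecidableEq J] in
/-- A balanced family lives on an index set of even size (`#P` is even in (4.1)). [cite: Hazama2003GHCCM, (4.C)/(4.1) p. 631] -/
theorem IsBalancedOn.two_dvd_card {Θ : J → CMType L} {T : Finset J} (hT : IsBalancedOn Θ T) :
    2 ∣ T.card := by
  obtain ⟨σ⟩ : Nonempty (L →+* ℂ) := inferInstance
  exact ⟨_, ((isBalancedOn_iff_two_mul Θ T).1 hT σ).symm⟩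

omit [NumberField L] [DecidableEq J] in
/-- **A paired target**: on an index set of even size there is a balanced block union made of complementary pairs
`{Θ₀, Θ̄₀}` (given any CM type `Θ₀`). [folklore] -/
private theorem exists_target (Θ₀ : CMType L) (h2 : 2 ∣ Fintype.card J) :
    ∃ H : J → CMType L, IsBlockUnion H Finset.univ := by
  obtain ⟨p, hp⟩ := h2
  let e : J ≃ Fin p ⊕ Fin p := (Fintype.equivFinOfCardEq (hp.trans (two_mul p))).trans finSumFinEquiv.symm
  let H₀ : Fin p ⊕ Fin p → CMType L := Sum.elim (fun _ => Θ₀) (fun _ => bar Θ₀)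
  refine ⟨H₀ ∘ e, ?_⟩
  -- `H₀` is a block union on `Fin p ⊕ Fin p`: the pairs `{inl j, inr j}`
  have hH₀ : ∀ s : Finset (Fin p), IsBlockUnion H₀ (s.disjiUnion (fun j => ({Sum.inl j, Sum.inr j} : Finset (Fin p ⊕ Fin p)))
      (fun i _ j _ hij => by simp [Finset.disjoint_left, hij])) := by
    intro s
    induction s using Finset.cons_induction with
    | empty => exact IsBlockUnion.empty.of_eq (by simp)
    | cons j s hj ih =>
      have hd : Disjoint ({Sum.inl j, Sum.inr j} : Finset (Fin p ⊕ Fin p))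
          (s.disjiUnion (fun j => ({Sum.inl j, Sum.inr j} : Finset (Fin p ⊕ Fin p)))
            (fun i _ j _ hij => by simp [Finset.disjoint_left, hij])) := by
        rw [Finset.disjoint_left]
        intro z hz hz'
        simp only [Finset.mem_insert, Finset.mem_singleton] at hz
        simp only [Finset.mem_disjiUnion, Finset.mem_insert, Finset.mem_singleton] at hz'
        obtain ⟨i, hi, hzi⟩ := hz'
        rcases hz with rfl | rfl <;> rcases hzi with h | h <;> simp_all
      refine (IsBlockUnion.cons ih hd (Or.inl (Finset.card_pair (by simp)))
        (isBalancedOn_pair_of_bar (Θ := H₀) (by simp) rfl)).of_eq ?_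
      rw [Finset.disjiUnion_cons]
  have huniv : (Finset.univ : Finset (Fin p ⊕ Fin p)) = (Finset.univ : Finset (Fin p)).disjiUnion
      (fun j => ({Sum.inl j, Sum.inr j} : Finset (Fin p ⊕ Fin p))) (fun i _ j _ hij => by simp [Finset.disjoint_left, hij]) := by
    ext z; rcases z with j | j <;> simp
  have hH₀u : IsBlockUnion H₀ (Finset.univ : Finset (Fin p ⊕ Fin p)) := (hH₀ Finset.univ).of_eq huniv.symm
  have := hH₀u.map e.symm.toEmbedding (Θ' := H₀ ∘ e) fun z => by simp
  exact this.of_eq (by ext z; simp)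

/-- **Every balanced family of CM types splits, after adjoining complementary pairs of new types, into balanced blocks
of size `2` or `4`.** For a number field `L`, a finite index type `J` and `Θ : J → CMType L` balanced on all of `J`
there are `k` and new types `Θ' : Fin k → CMType L` such that `Θ'` is itself a block union (a union of complementary
pairs) and the enlarged family `Sum.elim Θ Θ'` on `J ⊕ Fin k` is a block union. The ℤ-linear form of Hazama's
"`2`-dominated" (Thm. 7.14 with the transport of his [3]) — the true statement behind Milne's transcription Thm. 8.3,
whose literal ring-generation reading fails (Remark 7.15; tree barrier `CMHodgeRingNotGeneratedInCodimensionTwo`).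
[cite: Hazama2003GHCCM, Thm. 7.14, Remark 7.15 (p. 650) and Thm. 8.3 (p. 655)]
[cite: Milne2007TateFiniteFieldsAIM, Thm. 8.3 and Thm. 8.5] -/
theorem exists_isBlockUnion_sum_elim (Θ : J → CMType L) (hΘ : IsBalancedOn Θ Finset.univ) :
    ∃ (k : ℕ) (Θ' : Fin k → CMType L), IsBlockUnion Θ' Finset.univ ∧ IsBlockUnion (Sum.elim Θ Θ') Finset.univ := by
  by_cases hJ : Nonempty J
  · obtain ⟨x₀⟩ := hJ
    have h2 : 2 ∣ Fintype.card J := by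
      have := hΘ.two_dvd_card; rwa [Finset.card_univ] at this
    obtain ⟨H, hH⟩ := exists_target (Θ x₀) h2
    exact exists_isBlockUnion_aux H hH _ Θ hΘ le_rfl
  · rw [not_nonempty_iff] at hJ
    refine ⟨0, Fin.elim0, IsBlockUnion.empty.of_eq (Finset.univ_eq_empty).symm, IsBlockUnion.empty.of_eq ?_⟩
    exact (Finset.univ_eq_empty (α := J ⊕ Fin 0)).symm

end Main

end CMTypeFamily

end Literature.AlgebraicGeometry.HodgeTheory

end
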